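import Mathlib
import Literature.NumberTheory.LFunctions.Zhang2022.Section13Chain
import Literature.NumberTheory.LFunctions.Zhang2022.Section6Lemma61Closed
import Literature.NumberTheory.LFunctions.Zhang2022.ClosedFormsPartOne
import Literature.NumberTheory.LFunctions.Zhang2022.SkeletonEvalRel
import HarnessLib

/-!
# Zhang (2022) §13 — the per-zero chain (13.1) ⇒ (13.2) ⇒ (13.3) and the REPAIRED (13.7), kernel-closed
# (no hypothesis left): `u001_holds`, `u003_holds`, `eq132_holds`, `eq133_holds`, `eq137c_holds`

Topic `Literature/NumberTheory/LFunctions/Zhang2022` (Landau–Siegel audit tree; verdict-neutral).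
Y. Zhang, *Discrete mean estimates and the Landau–Siegel zero*, arXiv:2211.02515v1 (2022)
[Zhang2022LandauSiegel], §13 pp. 74–75 (tex L3721–L3805) — an unrefereed manuscript under adjudication;
nothing here asserts or denies its Theorems 1–2. Lane ZHANG-L (WP14), GAP row G-L3t6-2 (§13.u005 /
(13.7) with the Lemma-4.8 remainder carried along = the repaired reading of record).

The cell siegel-zhang left the §13 chain as EDGES from three skeleton leaves (`Section13Chain`:
`sec13_repaired_of_leaves : Prop22i → Lemma61 → Lemma48 → …`). Two of the three are tree theorems
(`Skeleton.prop22i_holds`, `Skeleton.lemma48_holds`); the third, Lemma 6.1 (`Skeleton.Lemma61`, stated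
for `|σ − ½| < 2α` and without Assumption (A)), is NOT — but the chain only ever applies it at the points
`ρ + β₂`, `ρ + β₃` (`ρ ∈ 𝔷(ψ)`), which lie ON the critical line (`Re ρ = ½` by Proposition 2.2 (i);
`β_j ∈ iℝ`, (2.13)), and under (A). There Lemma 6.1 IS a tree theorem with the printed error term:
`Section6Statements.lemma61_critical_line` (`Section6Lemma61Closed`, p-chain of sz L2 #10). This file
re-runs sz-d40's two "By Lemma 6.1" edges (`u001_of`, `u003_of`, `Section13ConjugateAFE` /
`Section13U003`) over that theorem — the proofs are theirs verbatim except for the one line invoking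
Lemma 6.1 (now fed `Re s = ½` and `hA`) — and composes with the landed edges `eq132_of`, `eq133_of`
(`TypedSection13Edges`), `u002_of_prop22i` (`Section13U002`), `eq131a_holds` (`Section13Eq131a`),
`u005c_of` / `eq137c_of` (`Section13U005Repaired`):

* `u001_holds`, `u003_holds` — the two "By Lemma 6.1" displays of p. 74, for every `c′` and every
  `c₀ ≤ c₁`, `c₁ > 0` THE constant `c` of Lemma 6.1's `ε = exp{−c𝓛¹⁰}` (uniform in `c′`);
* `eq132_holds`, `eq133_holds` — **(13.2) and (13.3) hold** (same quantifier shape);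
* `u005c_holds`, `eq137c_holds` — **the repaired §13.u005 and the repaired (13.7) hold**:
  `‖Ξ₁₄ + i(Φ₁ + Φ₂ − Φ₃)‖ ≤ C·(𝓔 + 𝓛⁻¹⁰⁰·ΣΣ‖L(ρ+β₁,ψ)N(ρ+β₂,ψ)N(ρ+β₃,ψ)B(ρ,ψ)/L′(ρ,ψ)‖·|ω(ρ)|)`
  for all large `D` under (A), every `c′`, every `c₀ ≤ c₁` (row G-L3t6-2's "decl wanted", now a theorem
  with no hypothesis);
* `eval137Rel_of_repaired` — bookkeeping edge for the skeleton pen: the consumed node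
  `Skeleton.Eval137Rel c′` follows from (13.11) in its relative reading of record (`Skeleton.Eq1311Rel c′ c₀`,
  leaf h1311) AND the relative estimate of the Lemma-4.8 remainder sum (stated inline as a hypothesis —
  an extra (13.11)-type verification the printed chain omits; NOT a node of the manuscript), for any
  `c₀ ≤ c₁`. The printed (13.7) (`Skeleton.Eq137 c′ c₀`, remainder absent, leaf h137) is not used.

Theorems only: no new definition, no new fact, axioms standard. What is NOT here: (13.11) itself
(`𝓔 = o(𝔓)`, "not carried out in print", G-L3t6-3), the remainder estimate, or the printed `Eq137`.

## References

* Y. Zhang, arXiv:2211.02515v1 (2022), §13 (13.1)–(13.7) pp. 74–75, tex L3733–L3805; §6 Lemma 6.1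
  p. 31; §4 Lemma 4.8 p. 22; §2 Prop. 2.2 (i), (2.13), (2.14). [cite: Zhang2022LandauSiegel, §13 pp.74–75]
-/

noncomputable section

open Complex Real ComplexConjugate

namespace Literature.NumberTheory.LFunctions.Zhang2022.Typed.Section13

open Skeleton GammaFactor

/-! ## Parameter bookkeeping (private copies of sz-d40's, `Section13ConjugateAFE` / `Section13U003`) -/

/-- `β₁ = iv₁`, `v₁ = α(1−5c′α𝓛)`. [cite: Zhang2022LandauSiegel, §2 (2.13)] -/
private theorem beta1_eq₃ (c' : ℝ) (D : ℕ) :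
    beta1 c' D = ((alpha D * (1 - 5 * c' * alpha D * ell D) : ℝ) : ℂ) * I := by
  simp only [beta1]; push_cast; ring

/-- `β₂ = iv₂`, `v₂ = 2α(1+c′α𝓛)`. [cite: Zhang2022LandauSiegel, §2 (2.13)] -/
private theorem beta2_eq₃ (c' : ℝ) (D : ℕ) :
    beta2 c' D = ((2 * alpha D * (1 + c' * alpha D * ell D) : ℝ) : ℂ) * I := by
  simp only [beta2]; push_cast; ring

/-- `β₃ = iv₃`, `v₃ = 3α(1−c′α𝓛)`. [cite: Zhang2022LandauSiegel, §2 (2.13)] -/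
private theorem beta3_eq₃ (c' : ℝ) (D : ℕ) :
    beta3 c' D = ((3 * alpha D * (1 - c' * alpha D * ell D) : ℝ) : ℂ) * I := by
  simp only [beta3]; push_cast; ring

/-- `α = π/𝓛⁹` ((2.10), `P = exp 𝓛⁹`). [cite: Zhang2022LandauSiegel, §2 (2.10)] -/
private theorem alpha_eq₃ (D : ℕ) : alpha D = π / ell D ^ 9 := by
  rw [alpha, bigP, Real.log_exp]

/-- For `𝓛 ≥ 1`: `0 < α`, `α𝓛 ≤ π` and `α ≤ π/𝓛`. [cite: Zhang2022LandauSiegel, §2 (2.10)] -/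
private theorem alpha_bounds₃ {D : ℕ} (hℓ : 1 ≤ ell D) :
    0 < alpha D ∧ 0 ≤ alpha D * ell D ∧ alpha D * ell D ≤ π ∧ alpha D ≤ π / ell D := by
  have hℓ0 : 0 < ell D := by linarith
  have h9 : 1 ≤ ell D ^ 9 := one_le_pow₀ hℓ
  have hα : alpha D = π / ell D ^ 9 := alpha_eq₃ D
  have hαpos : 0 < alpha D := by rw [hα]; positivity
  have h8 : ell D ≤ ell D ^ 9 := by
    calc ell D = ell D ^ 1 := (pow_one _).symm
      _ ≤ ell D ^ 9 := pow_le_pow_right₀ hℓ (by norm_num)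
  have hαℓ : alpha D * ell D ≤ π := by
    calc alpha D * ell D ≤ alpha D * ell D ^ 9 := by gcongr
      _ = π := by rw [hα, div_mul_cancel₀ _ (by positivity)]
  refine ⟨hαpos, by positivity, hαℓ, ?_⟩
  rw [le_div_iff₀ hℓ0]; exact hαℓ

/-- `|v₂|, |v₃| ≤ 3αK`, `K = 1 + 5π|c′|` (`𝓛 ≥ 1`). [cite: Zhang2022LandauSiegel, §2 (2.13)] -/
private theorem abs_v23_le {c' : ℝ} {D : ℕ} (hℓ : 1 ≤ ell D) :
    |2 * alpha D * (1 + c' * alpha D * ell D)| ≤ 3 * alpha D * (1 + 5 * π * |c'|) ∧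
      |3 * alpha D * (1 - c' * alpha D * ell D)| ≤ 3 * alpha D * (1 + 5 * π * |c'|) := by
  obtain ⟨hαpos, hαℓ0, hαℓ, -⟩ := alpha_bounds₃ hℓ
  have hc : 0 ≤ |c'| := abs_nonneg _
  have hπ : 0 ≤ π := pi_pos.le
  have hb : |c' * alpha D * ell D| ≤ π * |c'| := by
    rw [show c' * alpha D * ell D = c' * (alpha D * ell D) by ring, abs_mul, abs_of_nonneg hαℓ0]
    calc |c'| * (alpha D * ell D) ≤ |c'| * π := by gcongr
      _ = π * |c'| := by ring
  have h1 : |1 + c' * alpha D * ell D| ≤ 1 + π * |c'| := by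
    calc |1 + c' * alpha D * ell D| ≤ |(1 : ℝ)| + |c' * alpha D * ell D| := abs_add_le _ _
      _ ≤ 1 + π * |c'| := by rw [abs_one]; linarith
  have h2 : |1 - c' * alpha D * ell D| ≤ 1 + π * |c'| := by
    calc |1 - c' * alpha D * ell D| ≤ |(1 : ℝ)| + |c' * alpha D * ell D| := abs_sub _ _
      _ ≤ 1 + π * |c'| := by rw [abs_one]; linarith
  constructor
  · rw [abs_mul, abs_of_nonneg (by positivity : 0 ≤ 2 * alpha D)]
    calc 2 * alpha D * |1 + c' * alpha D * ell D| ≤ 2 * alpha D * (1 + π * |c'|) := by gcongr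
      _ ≤ 3 * alpha D * (1 + 5 * π * |c'|) := by nlinarith [mul_nonneg hπ hc, hαpos]
  · rw [abs_mul, abs_of_nonneg (by positivity : 0 ≤ 3 * alpha D)]
    calc 3 * alpha D * |1 - c' * alpha D * ell D| ≤ 3 * alpha D * (1 + π * |c'|) := by gcongr
      _ ≤ 3 * alpha D * (1 + 5 * π * |c'|) := by nlinarith [mul_nonneg hπ hc, hαpos]

/-- `|log u| ≤ 2|u − 1|` for `|u − 1| ≤ 1/2`. [folklore] -/
private theorem abs_log_le_two_mul₃ {u : ℝ} (hu : |u - 1| ≤ 1 / 2) : |Real.log u| ≤ 2 * |u - 1| := by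
  have hu1 := (abs_le.mp hu).1
  have hupos : 0 < u := by linarith
  have hup : Real.log u ≤ u - 1 := Real.log_le_sub_one_of_pos hupos
  have hlow : 1 - u⁻¹ ≤ Real.log u := Real.one_sub_inv_le_log_of_pos hupos
  rw [abs_le]
  constructor
  · have h2 : -(2 * |u - 1|) ≤ 1 - u⁻¹ := by
      have : 1 - u⁻¹ = (u - 1) / u := by field_simp
      rw [this, le_div_iff₀ hupos]
      have := neg_abs_le (u - 1)
      nlinarith [abs_nonneg (u - 1)]
    linarith
  · linarith [le_abs_self (u - 1), abs_nonneg (u - 1)]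

/-- The exponent of record: `α𝓛₁/(πt₀) = 𝓛⁻¹²³`. [cite: Zhang2022LandauSiegel, §5 Lemma 5.1] -/
private theorem alpha_ell1_div₃ {D : ℕ} (hℓ : (0 : ℝ) < ell D) :
    alpha D * ell1 D / (π * t0 D) = (ell D ^ 123)⁻¹ := by
  rw [alpha_eq₃, ell1, t0]
  have hπ : (π : ℝ) ≠ 0 := pi_pos.ne'
  have hℓ0 : ell D ≠ 0 := hℓ.ne'
  field_simp

/-- For `D ≥ ⌈exp M⌉` with `M ≥ 4`: `4 ≤ M ≤ 𝓛 ≤ t₀`, `𝓛₁ ≤ t₀`, `𝓛 > 0`.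
[cite: Zhang2022LandauSiegel, §2 (2.8)] -/
private theorem largeD₃ {M : ℝ} {D : ℕ} (hM4 : 4 ≤ M) (hD : ⌈Real.exp M⌉₊ ≤ D) :
    M ≤ ell D ∧ 1 ≤ ell D ∧ ell D ≤ t0 D ∧ ell1 D ≤ t0 D ∧ 0 < t0 D := by
  have hDreal : Real.exp M ≤ (D : ℝ) := le_trans (Nat.le_ceil _) (by exact_mod_cast hD)
  have hDpos : (0 : ℝ) < D := lt_of_lt_of_le (Real.exp_pos M) hDreal
  have hℓM : M ≤ ell D := by rw [ell]; exact (Real.le_log_iff_exp_le hDpos).mpr hDreal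
  have hℓ1 : 1 ≤ ell D := by linarith
  have ht0ℓ : ell D ≤ t0 D := by rw [t0]; exact le_self_pow₀ hℓ1 (by norm_num)
  have hℓ1t0 : ell1 D ≤ t0 D := by rw [ell1, t0]; exact pow_le_pow_right₀ hℓ1 (by norm_num)
  exact ⟨hℓM, hℓ1, ht0ℓ, hℓ1t0, by linarith⟩

/-- A zero `ρ ∈ 𝔷(ψ)` has `t₀ ≤ Im ρ` (once `𝓛₁ ≤ t₀`, `t₀ ≥ 0`).
[cite: Zhang2022LandauSiegel, §2 (2.14)] -/
private theorem t0_le_im₃ {D : ℕ} {x : Chr D} {ρ : ℂ} (hρ : ρ ∈ zeroSet D x)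
    (hℓ1t0 : ell1 D ≤ t0 D) (ht0 : 0 < t0 D) : t0 D ≤ ρ.im := by
  obtain ⟨-, him, -⟩ := hρ
  have h1 := (abs_lt.mp him).1
  have hπ : (3 : ℝ) < π := Real.pi_gt_three
  nlinarith

/-- On the critical line `1 − s = s̄`. [cite: Zhang2022LandauSiegel, §13 p.74] -/
private theorem one_sub_eq_conj₃ {s : ℂ} (hs : s.re = 1 / 2) : 1 - s = conj s := by
  apply Complex.ext
  · simp [hs]; norm_num
  · simp

/-! ## `Z22:§13.u001` outright -/

/-- **§13, display after (13.1), HOLDS** (Z22 p.74, tex L3739–3742): there is `c₁ > 0` (the constant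
`c` of Lemma 6.1's `ε = exp{−c𝓛¹⁰}`) such that for every `c₀ ≤ c₁` and every `c′`, `U001 c′ c₀`:
for `D` large under (A), `ψ ∈ Ψ₁`, `ρ ∈ 𝔷(ψ)`, `L(1−ρ−β₃,ψ̄) = \overline{L(ρ+β₃,ψ)}` exactly and
`‖L(1−ρ−β₃,ψ̄) − K(1−ρ−β₃,ψ̄) − Z(ρ+β₃,ψ)⁻¹N(ρ+β₃,ψ)‖ ≤ C·E₁(ρ+β₃,ψ)`. sz-d40's `u001_of` run over the
tree theorems `Skeleton.prop22i_holds` (Prop 2.2 (i)) and `Section6Statements.lemma61_critical_line`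
(Lemma 6.1 on `σ = ½`): `ρ + β₃` is on the critical line. [cite: Zhang2022LandauSiegel, §13 p.74] -/
theorem u001_holds : ∃ c₁ : ℝ, 0 < c₁ ∧ ∀ c₀ : ℝ, c₀ ≤ c₁ → ∀ c' : ℝ, U001 c' c₀ := by
  -- adapted from Section13ConjugateAFE.u001_of (sz-d40): Lemma 6.1 ↦ lemma61_critical_line
  obtain ⟨c, hc, C₁, D₆, h61⟩ := Section6Statements.lemma61_critical_line
  obtain ⟨D₂, h22⟩ := prop22i_holds
  refine ⟨c, hc, fun c₀ hc₀ c' => ?_⟩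
  set K : ℝ := 1 + 5 * π * |c'| with hK
  have hK1 : 1 ≤ K := by rw [hK]; nlinarith [pi_pos, abs_nonneg c']
  set M : ℝ := 4 + 3 * π * K with hM
  have hM4 : 4 ≤ M := by rw [hM]; nlinarith [pi_pos]
  refine ⟨max C₁ 0, max (max D₆ D₂) ⌈Real.exp M⌉₊, fun D _ χ hD hq hp hA x hx ρ hρ => ?_⟩
  have hD₆ : D₆ ≤ D := le_trans (le_trans (le_max_left _ _) (le_max_left _ _)) hD
  have hD₂ : D₂ ≤ D := le_trans (le_trans (le_max_right _ _) (le_max_left _ _)) hD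
  have hDM : ⌈Real.exp M⌉₊ ≤ D := le_trans (le_max_right _ _) hD
  obtain ⟨hℓM, hℓ1, ht0ℓ, hℓ1t0, ht0pos⟩ := largeD₃ hM4 hDM
  have hℓpos : 0 < ell D := by linarith
  -- the point `s = ρ + β₃` on the critical line
  have hre : ρ.re = 1 / 2 := h22 D χ hD₂ hq hp x hx ρ (mem_prodZeroSetOmega_of_mem_zeroSet χ hρ)
  have htt0 : t0 D ≤ ρ.im := t0_le_im₃ hρ hℓ1t0 ht0pos
  obtain ⟨-, him, -⟩ := hρ
  set s : ℂ := ρ + beta3 c' D with hs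
  obtain ⟨-, hav3⟩ := abs_v23_le (c' := c') hℓ1
  obtain ⟨hαpos, -, -, hαπℓ⟩ := alpha_bounds₃ hℓ1
  have hv3small : |3 * alpha D * (1 - c' * alpha D * ell D)| ≤ 1 := by
    refine le_trans hav3 ?_
    calc 3 * alpha D * K ≤ 3 * (π / ell D) * K := by gcongr
      _ = (3 * π * K) / ell D := by ring
      _ ≤ 1 := by rw [div_le_one hℓpos]; linarith
  have hsre : s.re = 1 / 2 := by
    rw [hs, Complex.add_re, hre, beta3_eq₃, Complex.mul_re, Complex.ofReal_re, Complex.ofReal_im,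
      Complex.I_re, Complex.I_im]; ring
  have hsim : s.im = ρ.im + 3 * alpha D * (1 - c' * alpha D * ell D) := by
    rw [hs, Complex.add_im, beta3_eq₃, Complex.mul_im, Complex.ofReal_re, Complex.ofReal_im,
      Complex.I_re, Complex.I_im]; ring
  have hsim_pos : 0 < s.im := by
    rw [hsim]; have := (abs_le.mp hv3small).1; linarith
  have hsrange2 : |s.im - 2 * π * t0 D| < ell1 D + 2 := by
    rw [hsim]
    calc |ρ.im + 3 * alpha D * (1 - c' * alpha D * ell D) - 2 * π * t0 D|
        = |(ρ.im - 2 * π * t0 D) + 3 * alpha D * (1 - c' * alpha D * ell D)| := by ring_nf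
      _ ≤ |ρ.im - 2 * π * t0 D| + |3 * alpha D * (1 - c' * alpha D * ell D)| := abs_add_le _ _
      _ < ell1 D + 2 := by linarith
  -- Lemma 6.1 (critical line, under (A)) at `s`, conjugated
  have h61s := h61 D χ hD₆ hq hp hA x s hsre hsrange2
  have hconj : 1 - ρ - beta3 c' D = conj s := by rw [hs, ← one_sub_eq_conj₃ hsre]; ring
  refine ⟨?_, ?_⟩
  · rw [hconj, LFunction_inv_conj, Complex.conj_conj]
  · rw [hconj, norm_afe_conj_eq x hsre hsim_pos]
    have hE : E1main x s + Real.exp (-c * ell D ^ 10) ≤ E1full c₀ x s := by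
      rw [E1full]
      have : Real.exp (-c * ell D ^ 10) ≤ Real.exp (-c₀ * ell D ^ 10) := by
        apply Real.exp_le_exp.mpr
        have : 0 ≤ ell D ^ 10 := by positivity
        nlinarith
      linarith
    have hE0 : 0 ≤ E1main x s + Real.exp (-c * ell D ^ 10) :=
      add_nonneg (E1main_nonneg x s) (Real.exp_nonneg _)
    calc _ ≤ C₁ * (E1main x s + Real.exp (-c * ell D ^ 10)) := h61s
      _ ≤ max C₁ 0 * (E1main x s + Real.exp (-c * ell D ^ 10)) :=
          mul_le_mul_of_nonneg_right (le_max_left _ _) hE0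
      _ ≤ max C₁ 0 * E1full c₀ x s := mul_le_mul_of_nonneg_left hE (le_max_right _ _)

/-! ## `Z22:§13.u003` outright -/

/-- **§13, display after (13.2), HOLDS** (Z22 p.74, tex L3755–3758): there is `c₁ > 0` (Lemma 6.1's `c`)
such that for every `c₀ ≤ c₁` and every `c′`, `U003 c′ c₀`: for `D` large under (A), `ψ ∈ Ψ₁`,
`ρ ∈ 𝔷(ψ)`, `‖(pt₀)^{β₁}L(1−ρ−β₂,ψ̄) − (pt₀)^{β₁}K(1−ρ−β₂,ψ̄) − (pt₀)^{β₃}Z(ρ,ψ)⁻¹N(ρ+β₂,ψ)‖`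
`≤ C(|N(ρ+β₂,ψ)|𝓛⁻¹²³ + E₁(ρ+β₂,ψ))`, `C = max(C₆₁, 32 + 6(1+5π|c′|))`. sz-d40's `u003_of` (Lemma 6.1
conjugated at `s = ρ + β₂` + the exact vertical shift `GammaFactor.Zfac_vertical_shift` for "Lemma 5.1",
`β₁ + β₂ = β₃`) run over `prop22i_holds` and `Section6Statements.lemma61_critical_line`.
[cite: Zhang2022LandauSiegel, §13 p.74] -/
theorem u003_holds : ∃ c₁ : ℝ, 0 < c₁ ∧ ∀ c₀ : ℝ, c₀ ≤ c₁ → ∀ c' : ℝ, U003 c' c₀ := by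
  -- adapted from Section13U003.u003_of (sz-d40): Lemma 6.1 ↦ lemma61_critical_line
  obtain ⟨c, hc, C₁, D₆, h61⟩ := Section6Statements.lemma61_critical_line
  obtain ⟨D₂, h22⟩ := prop22i_holds
  refine ⟨c, hc, fun c₀ hc₀ c' => ?_⟩
  set K : ℝ := 1 + 5 * π * |c'| with hK
  have hK1 : 1 ≤ K := by rw [hK]; nlinarith [pi_pos, abs_nonneg c']
  set M : ℝ := 16 + 3 * π * K with hM
  have hM4 : 4 ≤ M := by rw [hM]; nlinarith [pi_pos]
  refine ⟨max (max C₁ 0) (32 + 6 * K), max (max D₆ D₂) ⌈Real.exp M⌉₊,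
    fun D _ χ hD hq hp hA x hx ρ hρ => ?_⟩
  have hD₆ : D₆ ≤ D := le_trans (le_trans (le_max_left _ _) (le_max_left _ _)) hD
  have hD₂ : D₂ ≤ D := le_trans (le_trans (le_max_right _ _) (le_max_left _ _)) hD
  have hDM : ⌈Real.exp M⌉₊ ≤ D := le_trans (le_max_right _ _) hD
  obtain ⟨hℓM, hℓ1, ht0ℓ, hℓ1t0, ht0pos⟩ := largeD₃ hM4 hDM
  have hℓpos : 0 < ell D := by linarith
  have hℓ16 : 16 ≤ ell D := by
    have : 16 ≤ M := by rw [hM]; nlinarith [pi_pos]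
    linarith
  -- the zero and the point `s = ρ + β₂`
  have hre : ρ.re = 1 / 2 := h22 D χ hD₂ hq hp x hx ρ (mem_prodZeroSetOmega_of_mem_zeroSet χ hρ)
  have htt0 : t0 D ≤ ρ.im := t0_le_im₃ hρ hℓ1t0 ht0pos
  obtain ⟨-, him, -⟩ := hρ
  set t : ℝ := ρ.im with ht
  have htpos : 0 < t := lt_of_lt_of_le ht0pos htt0
  have ht4 : 4 * (1 : ℝ) ≤ t := by linarith
  have hρeq : ρ = ((1 / 2 : ℝ) : ℂ) + t * I := by
    rw [← hre]; exact (Complex.re_add_im ρ).symm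
  obtain ⟨hav2, -⟩ := abs_v23_le (c' := c') hℓ1
  obtain ⟨hαpos, -, -, hαπℓ⟩ := alpha_bounds₃ hℓ1
  set v1 : ℝ := alpha D * (1 - 5 * c' * alpha D * ell D) with hv1
  set v2 : ℝ := 2 * alpha D * (1 + c' * alpha D * ell D) with hv2
  set v3 : ℝ := 3 * alpha D * (1 - c' * alpha D * ell D) with hv3
  have hsum : v1 + v2 = v3 := by rw [hv1, hv2, hv3]; ring
  have h3αK : 3 * alpha D * K ≤ 1 := by
    calc 3 * alpha D * K ≤ 3 * (π / ell D) * K := by gcongr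
      _ = (3 * π * K) / ell D := by ring
      _ ≤ 1 := by rw [div_le_one hℓpos]; linarith
  have hv2small : |v2| ≤ 1 := le_trans hav2 h3αK
  have hvt2 : |v2| ≤ t / 2 := by linarith
  set s : ℂ := ρ + beta2 c' D with hs
  have hs' : s = ((1 / 2 : ℝ) : ℂ) + t * I + (v2 : ℂ) * I := by rw [hs, beta2_eq₃, hρeq]
  have hsre : s.re = 1 / 2 := by rw [hs']; simp
  have hsim : s.im = t + v2 := by rw [hs']; simp
  have hsim_pos : 0 < s.im := by rw [hsim]; have := (abs_le.mp hv2small).1; linarith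
  have hsrange2 : |s.im - 2 * π * t0 D| < ell1 D + 2 := by
    rw [hsim]
    calc |t + v2 - 2 * π * t0 D| = |(t - 2 * π * t0 D) + v2| := by ring_nf
      _ ≤ |t - 2 * π * t0 D| + |v2| := abs_add_le _ _
      _ < ell1 D + 2 := by linarith
  -- Lemma 6.1 (critical line, under (A)) at `s`, conjugated: the remainder `R`
  have h61s := h61 D χ hD₆ hq hp hA x s hsre hsrange2
  have hconj : 1 - ρ - beta2 c' D = conj s := by rw [hs, ← one_sub_eq_conj₃ hsre]; ring
  set R : ℂ := x.ψ⁻¹.LFunction (conj s) - Kchar D (psiBarFn x) (conj s) -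
    (Zfac x.ψ s)⁻¹ * Nchar D (psiFn x) s with hR
  have hRle : ‖R‖ ≤ max C₁ 0 * E1full c₀ x s := by
    rw [hR, norm_afe_conj_eq x hsre hsim_pos]
    have hE : E1main x s + Real.exp (-c * ell D ^ 10) ≤ E1full c₀ x s := by
      rw [E1full]
      have : Real.exp (-c * ell D ^ 10) ≤ Real.exp (-c₀ * ell D ^ 10) := by
        apply Real.exp_le_exp.mpr
        have : 0 ≤ ell D ^ 10 := by positivity
        nlinarith
      linarith
    have hE0 : 0 ≤ E1main x s + Real.exp (-c * ell D ^ 10) :=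
      add_nonneg (E1main_nonneg x s) (Real.exp_nonneg _)
    calc _ ≤ C₁ * (E1main x s + Real.exp (-c * ell D ^ 10)) := h61s
      _ ≤ max C₁ 0 * (E1main x s + Real.exp (-c * ell D ^ 10)) :=
          mul_le_mul_of_nonneg_right (le_max_left _ _) hE0
      _ ≤ max C₁ 0 * E1full c₀ x s := mul_le_mul_of_nonneg_left hE (le_max_right _ _)
  -- the factors `(pt₀)^{β₁}`, `(pt₀)^{β₃}`
  have hb : 0 < (x.p : ℝ) * t0 D := mul_pos (Nat.cast_pos.mpr x.prime.pos) ht0pos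
  set L₀ : ℝ := Real.log ((x.p : ℝ) * t0 D) with hL₀
  have hpow1 : ((((x.p : ℝ) * t0 D : ℝ)) : ℂ) ^ beta1 c' D = cexp (((v1 * L₀ : ℝ)) * I) := by
    rw [Complex.cpow_def_of_ne_zero (by exact_mod_cast hb.ne'), ← Complex.ofReal_log hb.le,
      beta1_eq₃]
    congr 1
    rw [hv1, hL₀]; push_cast; ring
  have hpow3 : ((((x.p : ℝ) * t0 D : ℝ)) : ℂ) ^ beta3 c' D =
      cexp (((v1 * L₀ : ℝ)) * I) * cexp (((v2 * L₀ : ℝ)) * I) := by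
    rw [Complex.cpow_def_of_ne_zero (by exact_mod_cast hb.ne'), ← Complex.ofReal_log hb.le,
      beta3_eq₃, ← Complex.exp_add]
    congr 1
    rw [hL₀, hv1, hv2]; push_cast; ring
  have hB1norm : ‖cexp (((v1 * L₀ : ℝ)) * I)‖ = 1 := Complex.norm_exp_ofReal_mul_I _
  -- the vertical shift at `v₂`
  obtain ⟨η₂, hη₂, hZ2⟩ := Zfac_vertical_shift x.prim le_rfl (by norm_num : (0 : ℝ) < 1 / 2)
    (by norm_num : (1 / 2 : ℝ) ≤ 1) ht4 hvt2
  set L : ℂ := ((Real.log ((x.p : ℝ) * t / (2 * π)) : ℝ) : ℂ) with hL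
  set Z0 : ℂ := Zfac x.ψ (((1 / 2 : ℝ) : ℂ) + t * I) with hZ0
  have hZ0ρ : Zfac x.ψ ρ = Z0 := by rw [hZ0, hρeq]
  have hZ0norm : ‖Z0‖ = 1 := by
    rw [hZ0]
    have : ((1 / 2 : ℝ) : ℂ) + t * I = 1 / 2 + t * I := by push_cast; ring
    rw [this]; exact norm_Zfac_half_eq_one x.prim htpos
  have hZ0ne : Z0 ≠ 0 := by
    intro h; rw [h, norm_zero] at hZ0norm; exact zero_ne_one hZ0norm
  have hZs : Zfac x.ψ s = Z0 * cexp (-((v2 : ℂ) * L) * I) * cexp η₂ := by rw [hs']; exact hZ2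
  have hinv2 : (Zfac x.ψ s)⁻¹ = Z0⁻¹ * cexp ((v2 : ℂ) * L * I) * cexp (-η₂) := by
    rw [hZs]
    apply inv_eq_of_mul_eq_one_right
    have hc1 : cexp (-((v2 : ℂ) * L) * I) * cexp ((v2 : ℂ) * L * I) = 1 := by
      rw [← Complex.exp_add, show -((v2 : ℂ) * L) * I + (v2 : ℂ) * L * I = 0 by ring,
        Complex.exp_zero]
    calc Z0 * cexp (-((v2 : ℂ) * L) * I) * cexp η₂ * (Z0⁻¹ * cexp ((v2 : ℂ) * L * I) * cexp (-η₂))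
        = (Z0 * Z0⁻¹) * (cexp (-((v2 : ℂ) * L) * I) * cexp ((v2 : ℂ) * L * I)) *
            (cexp η₂ * cexp (-η₂)) := by ring
      _ = 1 := by
          rw [mul_inv_cancel₀ hZ0ne, hc1, ← Complex.exp_add, add_neg_cancel, Complex.exp_zero]; ring
  -- the discrepancy `Δ = (pt₀)^{β₁}Z(s)⁻¹ − (pt₀)^{β₃}Z(ρ)⁻¹`
  set θ : ℝ := v2 * (L₀ - Real.log ((x.p : ℝ) * t / (2 * π))) with hθ
  have hsplit : cexp (((v2 * L₀ : ℝ)) * I) = cexp ((v2 : ℂ) * L * I) * cexp ((θ : ℂ) * I) := by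
    rw [← Complex.exp_add]; congr 1; rw [hθ, hL]; push_cast; ring
  have hΔ : cexp (((v1 * L₀ : ℝ)) * I) * (Zfac x.ψ s)⁻¹ -
      cexp (((v1 * L₀ : ℝ)) * I) * cexp (((v2 * L₀ : ℝ)) * I) * Z0⁻¹ =
      cexp (((v1 * L₀ : ℝ)) * I) * Z0⁻¹ * cexp ((v2 : ℂ) * L * I) *
        (cexp (-η₂) - cexp ((θ : ℂ) * I)) := by
    rw [hinv2, hsplit]; ring
  -- `|θ| ≤ 3K 𝓛⁻¹²³`
  have hθ_le : |θ| ≤ 3 * K * (ell D ^ 123)⁻¹ := by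
    have hp0 : (0 : ℝ) < x.p := Nat.cast_pos.mpr x.prime.pos
    have h2π : (0 : ℝ) < 2 * π := mul_pos two_pos pi_pos
    have h2πt0 : (0 : ℝ) < 2 * π * t0 D := mul_pos h2π ht0pos
    set u : ℝ := t / (2 * π * t0 D) with hu
    have hupos : 0 < u := div_pos htpos h2πt0
    have hlog : L₀ - Real.log ((x.p : ℝ) * t / (2 * π)) = -Real.log u := by
      rw [hL₀, hu, Real.log_div (mul_pos hp0 htpos).ne' h2π.ne', Real.log_mul hp0.ne' ht0pos.ne',
        Real.log_mul hp0.ne' htpos.ne', Real.log_div htpos.ne' h2πt0.ne',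
        Real.log_mul h2π.ne' ht0pos.ne']
      ring
    have hu1 : |u - 1| ≤ ell1 D / (2 * π * t0 D) := by
      have hne : 2 * π * t0 D ≠ 0 := h2πt0.ne'
      have : u - 1 = (t - 2 * π * t0 D) / (2 * π * t0 D) := by rw [hu]; field_simp
      rw [this, abs_div, abs_of_pos h2πt0]
      exact div_le_div_of_nonneg_right him.le h2πt0.le
    have hu_half : |u - 1| ≤ 1 / 2 := by
      refine le_trans hu1 ?_
      rw [div_le_iff₀ h2πt0]
      have hπ3 : (3 : ℝ) < π := Real.pi_gt_three
      have h1 : t0 D ≤ π * t0 D := le_mul_of_one_le_left ht0pos.le (by linarith only [hπ3])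
      linarith only [hℓ1t0, h1]
    have hlogu : |Real.log u| ≤ 2 * (ell1 D / (2 * π * t0 D)) :=
      le_trans (abs_log_le_two_mul₃ hu_half) (mul_le_mul_of_nonneg_left hu1 zero_le_two)
    have hπ0 : (π : ℝ) ≠ 0 := pi_pos.ne'
    have ht00 : t0 D ≠ 0 := ht0pos.ne'
    have halg : (3 * alpha D * K) * (2 * (ell1 D / (2 * π * t0 D))) =
        3 * K * (alpha D * ell1 D / (π * t0 D)) := by
      field_simp
    calc |θ| = |v2| * |Real.log u| := by rw [hθ, hlog, abs_mul, abs_neg]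
      _ ≤ (3 * alpha D * K) * (2 * (ell1 D / (2 * π * t0 D))) :=
          mul_le_mul hav2 hlogu (abs_nonneg _) (by nlinarith only [hαpos, hK1])
      _ = 3 * K * (alpha D * ell1 D / (π * t0 D)) := halg
      _ = 3 * K * (ell D ^ 123)⁻¹ := by rw [alpha_ell1_div₃ hℓpos]
  have h123ℓ : ell D ≤ ell D ^ 123 := le_self_pow₀ hℓ1 (by norm_num)
  have hinv0 : 0 ≤ (ell D ^ 123)⁻¹ := inv_nonneg.mpr (pow_nonneg hℓpos.le _)
  have hθ1 : ‖((θ : ℂ)) * I‖ ≤ 1 := by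
    rw [norm_mul, Complex.norm_I, mul_one, Complex.norm_real, Real.norm_eq_abs]
    refine le_trans hθ_le ?_
    rw [← div_eq_mul_inv, div_le_one (pow_pos hℓpos 123)]
    have : 3 * K ≤ M := by rw [hM]; nlinarith only [hK1, Real.pi_gt_three]
    linarith only [this, hℓM, h123ℓ]
  -- `‖η₂‖ ≤ 16/t ≤ 16 𝓛⁻¹²³ ≤ 1`
  have hη₂' : ‖η₂‖ ≤ 16 / t := by
    refine le_trans hη₂ (div_le_div_of_nonneg_right ?_ htpos.le)
    have h0 : 0 ≤ |v2| := abs_nonneg _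
    nlinarith only [h0, hv2small]
  have h16 : 16 / t ≤ 16 * (ell D ^ 123)⁻¹ := by
    have h1 : ell D ^ 123 ≤ t0 D := by rw [t0]; exact pow_le_pow_right₀ hℓ1 (by norm_num)
    calc 16 / t ≤ 16 / ell D ^ 123 :=
          div_le_div_of_nonneg_left (by norm_num) (pow_pos hℓpos 123) (h1.trans htt0)
      _ = 16 * (ell D ^ 123)⁻¹ := div_eq_mul_inv _ _
  have hη₂1 : ‖η₂‖ ≤ 1 := by
    refine le_trans hη₂' ?_
    rw [div_le_one htpos]; linarith only [hℓ16, ht0ℓ, htt0]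
  have hA : ‖cexp (-η₂) - 1‖ ≤ 2 * (16 / t) := by
    calc ‖cexp (-η₂) - 1‖ ≤ 2 * ‖-η₂‖ := Complex.norm_exp_sub_one_le (by rw [norm_neg]; exact hη₂1)
      _ ≤ 2 * (16 / t) := by rw [norm_neg]; exact mul_le_mul_of_nonneg_left hη₂' zero_le_two
  have hC : ‖cexp ((θ : ℂ) * I) - 1‖ ≤ 2 * (3 * K * (ell D ^ 123)⁻¹) := by
    calc ‖cexp ((θ : ℂ) * I) - 1‖ ≤ 2 * ‖(θ : ℂ) * I‖ := Complex.norm_exp_sub_one_le hθ1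
      _ ≤ 2 * (3 * K * (ell D ^ 123)⁻¹) := by
          rw [norm_mul, Complex.norm_I, mul_one, Complex.norm_real, Real.norm_eq_abs]
          exact mul_le_mul_of_nonneg_left hθ_le zero_le_two
  have hv2L : ‖cexp ((v2 : ℂ) * L * I)‖ = 1 := by
    have : (v2 : ℂ) * L * I = ((v2 * Real.log ((x.p : ℝ) * t / (2 * π)) : ℝ) : ℂ) * I := by
      rw [hL]; push_cast; ring
    rw [this]; exact Complex.norm_exp_ofReal_mul_I _
  have hΔnorm : ‖cexp (((v1 * L₀ : ℝ)) * I) * (Zfac x.ψ s)⁻¹ -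
      cexp (((v1 * L₀ : ℝ)) * I) * cexp (((v2 * L₀ : ℝ)) * I) * Z0⁻¹‖ ≤ (32 + 6 * K) * (ell D ^ 123)⁻¹ := by
    rw [hΔ, norm_mul, norm_mul, norm_mul, hB1norm, norm_inv, hZ0norm, hv2L, inv_one, one_mul,
      one_mul, one_mul]
    calc ‖cexp (-η₂) - cexp ((θ : ℂ) * I)‖ = ‖(cexp (-η₂) - 1) - (cexp ((θ : ℂ) * I) - 1)‖ := by ring_nf
      _ ≤ ‖cexp (-η₂) - 1‖ + ‖cexp ((θ : ℂ) * I) - 1‖ := norm_sub_le _ _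
      _ ≤ 2 * (16 / t) + 2 * (3 * K * (ell D ^ 123)⁻¹) := add_le_add hA hC
      _ ≤ 2 * (16 * (ell D ^ 123)⁻¹) + 2 * (3 * K * (ell D ^ 123)⁻¹) := by linarith only [h16]
      _ = (32 + 6 * K) * (ell D ^ 123)⁻¹ := by ring
  -- assemble
  have hE : (((x.p : ℝ) * t0 D : ℝ) : ℂ) ^ beta1 c' D * x.ψ⁻¹.LFunction (1 - ρ - beta2 c' D) -
      ((((x.p : ℝ) * t0 D : ℝ) : ℂ) ^ beta1 c' D * Kchar D (psiBarFn x) (1 - ρ - beta2 c' D) +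
        (((x.p : ℝ) * t0 D : ℝ) : ℂ) ^ beta3 c' D * (Zfac x.ψ ρ)⁻¹ * Nchar D (psiFn x) (ρ + beta2 c' D)) =
      cexp (((v1 * L₀ : ℝ)) * I) * R +
        (cexp (((v1 * L₀ : ℝ)) * I) * (Zfac x.ψ s)⁻¹ -
          cexp (((v1 * L₀ : ℝ)) * I) * cexp (((v2 * L₀ : ℝ)) * I) * Z0⁻¹) * Nchar D (psiFn x) s := by
    rw [hpow1, hpow3, hconj, hZ0ρ, hR, ← hs]; ring
  rw [hE]
  have hN0 : 0 ≤ ‖Nchar D (psiFn x) s‖ := norm_nonneg _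
  have hEf0 : 0 ≤ E1full c₀ x s := add_nonneg (E1main_nonneg x s) (Real.exp_nonneg _)
  calc ‖cexp (((v1 * L₀ : ℝ)) * I) * R +
        (cexp (((v1 * L₀ : ℝ)) * I) * (Zfac x.ψ s)⁻¹ -
          cexp (((v1 * L₀ : ℝ)) * I) * cexp (((v2 * L₀ : ℝ)) * I) * Z0⁻¹) * Nchar D (psiFn x) s‖
      ≤ ‖cexp (((v1 * L₀ : ℝ)) * I) * R‖ +
        ‖(cexp (((v1 * L₀ : ℝ)) * I) * (Zfac x.ψ s)⁻¹ -
          cexp (((v1 * L₀ : ℝ)) * I) * cexp (((v2 * L₀ : ℝ)) * I) * Z0⁻¹) * Nchar D (psiFn x) s‖ :=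
        norm_add_le _ _
    _ = ‖R‖ + ‖cexp (((v1 * L₀ : ℝ)) * I) * (Zfac x.ψ s)⁻¹ -
          cexp (((v1 * L₀ : ℝ)) * I) * cexp (((v2 * L₀ : ℝ)) * I) * Z0⁻¹‖ * ‖Nchar D (psiFn x) s‖ := by
        rw [norm_mul, hB1norm, one_mul, norm_mul]
    _ ≤ max C₁ 0 * E1full c₀ x s + (32 + 6 * K) * (ell D ^ 123)⁻¹ * ‖Nchar D (psiFn x) s‖ := by
        gcongr
    _ ≤ max (max C₁ 0) (32 + 6 * K) * E1full c₀ x s +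
        max (max C₁ 0) (32 + 6 * K) * (ell D ^ 123)⁻¹ * ‖Nchar D (psiFn x) s‖ :=
        add_le_add (mul_le_mul_of_nonneg_right (le_max_left _ _) hEf0)
          (mul_le_mul_of_nonneg_right (mul_le_mul_of_nonneg_right (le_max_right _ _) hinv0) hN0)
    _ = max (max C₁ 0) (32 + 6 * K) *
        (‖Nchar D (psiFn x) s‖ * (ell D ^ 123)⁻¹ + E1full c₀ x s) := by ring

/-! ## (13.2), (13.3) and the repaired (13.7), outright -/

/-- **`Z22:(13.2)` HOLDS** (Z22 p.74, (13.2), tex L3748–3752): for every `c₀ ≤ c₁` (`c₁ > 0` Lemma 6.1's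
`c`) and every `c′`, `Eq132 c′ c₀` — `eq132_of` (L3-t6) ∘ (`u001_holds`, `u002_of_prop22i prop22i_holds`).
[cite: Zhang2022LandauSiegel, §13 (13.2) p.74] -/
theorem eq132_holds : ∃ c₁ : ℝ, 0 < c₁ ∧ ∀ c₀ : ℝ, c₀ ≤ c₁ → ∀ c' : ℝ, Eq132 c' c₀ := by
  obtain ⟨c₁, hc₁, h1⟩ := u001_holds
  exact ⟨c₁, hc₁, fun c₀ hc₀ c' => eq132_of (h1 c₀ hc₀ c') (u002_of_prop22i prop22i_holds c')⟩

/-- **`Z22:(13.3)` HOLDS** (Z22 p.74, (13.3), tex L3759–3773: "We insert this into (13.2) and then insert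
the result into (13.1). Thus we obtain `𝒞*(ρ,ψ) = [main133] + O(E₁*(ρ,ψ))`"): for every `c₀ ≤ c₁`
(`c₁ > 0`, the smaller of the two Lemma-6.1 thresholds) and every `c′`, `Eq133 c′ c₀` — `eq133_of`
(L3-t6) ∘ (`prop22i_holds`, `eq131a_holds`, `eq132_holds`, `u003_holds`). No hypothesis.
[cite: Zhang2022LandauSiegel, §13 (13.3) p.74] -/
theorem eq133_holds : ∃ c₁ : ℝ, 0 < c₁ ∧ ∀ c₀ : ℝ, c₀ ≤ c₁ → ∀ c' : ℝ, Eq133 c' c₀ := by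
  obtain ⟨c₁, hc₁, h132⟩ := eq132_holds
  obtain ⟨c₃, hc₃, h3⟩ := u003_holds
  refine ⟨min c₁ c₃, lt_min hc₁ hc₃, fun c₀ hc₀ c' => ?_⟩
  exact eq133_of prop22i_holds (eq131a_holds c') (h132 c₀ (le_trans hc₀ (min_le_left _ _)) c')
    (h3 c₀ (le_trans hc₀ (min_le_right _ _)) c')

/-- **`Z22:§13.u005`, repaired, HOLDS** (Z22 p.75, tex L3774–L3777; GAP-LEDGER G-L3t6-2): for every
`c₀ ≤ c₁` and every `c′`, for `D` large under (A), `ψ ∈ Ψ₁`, `ρ ∈ 𝔷(ψ)`,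
`‖𝒞*(ρ,ψ)Z(ρ,χψ)⁻¹B(ρ,ψ) + i(𝒦*₁ + (pt₀)^{β₁}𝒦*₂ − (pt₀)^{β₃}𝒦*₃)‖`
`≤ C·(E₁*(ρ,ψ)‖B(ρ,ψ)‖ + 𝓛⁻¹⁰⁰·‖L(ρ+β₁,ψ)N(ρ+β₂,ψ)N(ρ+β₃,ψ)B(ρ,ψ)/L′(ρ,ψ)‖)` — sz-d42's `u005c_of` ∘
(`eq133_holds`, `lemma48_holds`, `prop22i_holds`). The second term is the Lemma-4.8 remainder the
printed display omits. [cite: Zhang2022LandauSiegel, §13 p.75, tex L3774–L3777] -/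
theorem u005c_holds : ∃ c₁ : ℝ, 0 < c₁ ∧ ∀ c₀ : ℝ, c₀ ≤ c₁ → ∀ c' : ℝ,
    ∃ C : ℝ, ForAllLarge fun D _ χ => AssumptionA D χ → ∀ x ∈ PsiOne χ, ∀ ρ ∈ zeroSet D x,
      ‖cstar c' D x ρ * (Zpc χ x ρ)⁻¹ * Bpoly χ x ρ +
          I * (kstar1 c' χ x ρ + (((x.p : ℝ) * t0 D : ℝ) : ℂ) ^ beta1 c' D * kstar2 c' χ x ρ -
            (((x.p : ℝ) * t0 D : ℝ) : ℂ) ^ beta3 c' D * kstar3 c' χ x ρ)‖ ≤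
        C * (E1star c' c₀ x ρ * ‖Bpoly χ x ρ‖ + (ell D ^ 100)⁻¹ *
          ‖x.ψ.LFunction (ρ + beta1 c' D) * Nchar D (psiFn x) (ρ + beta2 c' D) *
              Nchar D (psiFn x) (ρ + beta3 c' D) * Bpoly χ x ρ / deriv x.ψ.LFunction ρ‖) := by
  obtain ⟨c₁, hc₁, h133⟩ := eq133_holds
  exact ⟨c₁, hc₁, fun c₀ hc₀ c' => u005c_of c' c₀ (h133 c₀ hc₀ c') lemma48_holds prop22i_holds⟩

/-- **`Z22:(13.7)`, repaired, HOLDS — no hypothesis** (Z22 p.75, (13.7), tex L3788–L3805; GAP row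
G-L3t6-2): there is `c₁ > 0` (Lemma 6.1's constant) such that for every `c₀ ≤ c₁` and every `c′` there is
`C` with, for all large `D` under (A),
`‖Ξ₁₄ + i(Φ₁ + Φ₂ − Φ₃)‖ ≤ C·(𝓔 + 𝓛⁻¹⁰⁰·ΣΣ‖L(ρ+β₁,ψ)N(ρ+β₂,ψ)N(ρ+β₃,ψ)B(ρ,ψ)/L′(ρ,ψ)‖·|ω(ρ)|)`
(`Ξ₁₄` (12.4), `Φⱼ` (13.8)–(13.10), `𝓔 = Skeleton.frakE c′ c₀` the display after (13.10)) — sz-d42's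
`eq137c_of` ∘ (`eq133_holds`, `lemma48_holds`, `prop22i_holds`). The printed (13.7), `Skeleton.Eq137 c′ c₀`,
is this bound with the second sum absent. [cite: Zhang2022LandauSiegel, §13 (13.7) p.75] -/
theorem eq137c_holds : ∃ c₁ : ℝ, 0 < c₁ ∧ ∀ c₀ : ℝ, c₀ ≤ c₁ → ∀ c' : ℝ,
    ∃ C : ℝ, ForAllLarge fun D _ χ => AssumptionA D χ →
      ‖xi14 c' χ + I * (Phi1 c' χ + Phi2 c' χ - Phi3 c' χ)‖ ≤
        C * (frakE c' c₀ χ + (ell D ^ 100)⁻¹ * ∑ i ∈ idx χ,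
          ‖i.1.ψ.LFunction (i.2 + beta1 c' D) * Nchar D (psiFn i.1) (i.2 + beta2 c' D) *
              Nchar D (psiFn i.1) (i.2 + beta3 c' D) * Bpoly χ i.1 i.2 /
              deriv i.1.ψ.LFunction i.2‖ * ‖omegaW D i.2‖) := by
  obtain ⟨c₁, hc₁, h133⟩ := eq133_holds
  exact ⟨c₁, hc₁, fun c₀ hc₀ c' => eq137c_of c' c₀ (h133 c₀ hc₀ c') lemma48_holds prop22i_holds⟩

/-! ## The consumed node `Eval137Rel` from (13.11)ᴿ and the remainder estimate -/

/-- **Edge for the skeleton pen** (relative reading of record, `SkeletonEvalRel`): for `c₀ ≤ c₁`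
(`c₁ > 0` of `eq137c_holds`), the consumed form of (13.7), `Skeleton.Eval137Rel c′`
(`‖Ξ₁₄ + i(Φ₁+Φ₂−Φ₃)‖ ≤ ε(𝔞+1)𝔓` eventually), follows from the leaf (13.11)ᴿ `Skeleton.Eq1311Rel c′ c₀`
(`𝓔 ≤ ε(𝔞+1)𝔓`) together with the matching estimate for the Lemma-4.8 remainder sum,
`𝓛⁻¹⁰⁰·ΣΣ‖L(ρ+β₁,ψ)N(ρ+β₂,ψ)N(ρ+β₃,ψ)B(ρ,ψ)/L′(ρ,ψ)‖·|ω(ρ)| ≤ ε(𝔞+1)𝔓` (every `ε > 0`, eventually) —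
an extra (13.11)-type verification NOT displayed in the manuscript, carried here as an explicit
hypothesis. With it the printed leaf `Skeleton.Eq137 c′ c₀` is not needed. Kernel bookkeeping only.
[cite: Zhang2022LandauSiegel, §13 (13.7), (13.11) p.75] -/
theorem eval137Rel_of_repaired : ∃ c₁ : ℝ, 0 < c₁ ∧ ∀ c₀ : ℝ, c₀ ≤ c₁ → ∀ c' : ℝ,
    Eq1311Rel c' c₀ →
    (∀ ε : ℝ, 0 < ε → ForAllLarge fun D _ χ => AssumptionA D χ →
      (ell D ^ 100)⁻¹ * (∑ i ∈ idx χ,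
          ‖i.1.ψ.LFunction (i.2 + beta1 c' D) * Nchar D (psiFn i.1) (i.2 + beta2 c' D) *
              Nchar D (psiFn i.1) (i.2 + beta3 c' D) * Bpoly χ i.1 i.2 /
              deriv i.1.ψ.LFunction i.2‖ * ‖omegaW D i.2‖) ≤ ε * (frakA χ + 1) * frakP D) →
    Eval137Rel c' := by
  obtain ⟨c₁, hc₁, h137c⟩ := eq137c_holds
  refine ⟨c₁, hc₁, fun c₀ hc₀ c' h1311 hE' => ?_⟩
  intro ε hε
  obtain ⟨C, hC⟩ := h137c c₀ hc₀ c'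
  have hε' : 0 < ε / (2 * (|C| + 1)) := by positivity
  obtain ⟨D₀, h⟩ := (hC.and (h1311 _ hε')).and (hE' _ hε')
  refine ⟨D₀, fun D _ χ hD hq hp hA => ?_⟩
  obtain ⟨⟨h1, h2⟩, h3⟩ := h D χ hD hq hp
  have hAP : 0 ≤ (frakA χ + 1) * frakP D :=
    mul_nonneg (by linarith [frakA_nonneg χ]) (frakP_nonneg D)
  have hE0 : 0 ≤ frakE c' c₀ χ := frakE_nonneg c' c₀ χ
  have hS0 : 0 ≤ (ell D ^ 100)⁻¹ * (∑ i ∈ idx χ,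
      ‖i.1.ψ.LFunction (i.2 + beta1 c' D) * Nchar D (psiFn i.1) (i.2 + beta2 c' D) *
          Nchar D (psiFn i.1) (i.2 + beta3 c' D) * Bpoly χ i.1 i.2 /
          deriv i.1.ψ.LFunction i.2‖ * ‖omegaW D i.2‖) :=
    mul_nonneg (inv_nonneg.mpr (pow_nonneg (Real.log_natCast_nonneg D) _))
      (Finset.sum_nonneg fun i _ => mul_nonneg (norm_nonneg _) (norm_nonneg _))
  have hb1 := h2 hA
  have hb2 := h3 hA
  calc ‖xi14 c' χ + I * (Phi1 c' χ + Phi2 c' χ - Phi3 c' χ)‖ ≤ C * _ := h1 hA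
    _ ≤ |C| * (frakE c' c₀ χ + (ell D ^ 100)⁻¹ * (∑ i ∈ idx χ,
          ‖i.1.ψ.LFunction (i.2 + beta1 c' D) * Nchar D (psiFn i.1) (i.2 + beta2 c' D) *
              Nchar D (psiFn i.1) (i.2 + beta3 c' D) * Bpoly χ i.1 i.2 /
              deriv i.1.ψ.LFunction i.2‖ * ‖omegaW D i.2‖)) :=
        mul_le_mul_of_nonneg_right (le_abs_self C) (add_nonneg hE0 hS0)
    _ ≤ |C| * (ε / (2 * (|C| + 1)) * (frakA χ + 1) * frakP D +
          ε / (2 * (|C| + 1)) * (frakA χ + 1) * frakP D) := by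
        gcongr
    _ = (|C| / (|C| + 1)) * (ε * ((frakA χ + 1) * frakP D)) := by field_simp; ring
    _ ≤ 1 * (ε * ((frakA χ + 1) * frakP D)) :=
        mul_le_mul_of_nonneg_right (by rw [div_le_one (by positivity)]; linarith)
          (mul_nonneg hε.le hAP)
    _ = ε * (frakA χ + 1) * frakP D := by ring

end Literature.NumberTheory.LFunctions.Zhang2022.Typed.Section13

end
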